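import Literature.Barriers.RiemannHypothesis.JensenPolynomialsSqrt
import HarnessLib

/-!
# Splittings / Jensen — the MIXED-SPLIT WITNESS family `F_{c,ε}(w) = ((w + c)² + ε²)·cosh √w`, part 1/3:
# zero structure, symmetry, growth (order `< 1` for `F` and `F'`)

Cell rh-split, seat rh-split-jen-bridge (gen 2 §§0–2; card `cards/SPLIT-jen-bridge.md` §9–§10), scratch
`HOME/rh-split-jen-bridge/SketchG3.lean` §§1–2; filed zero-def by rh-split-typer-1 g3 on the lead's order
(G1, option C). Part 2 (`JensenMixedSplitRows.lean`) does the Jensen-row bookkeeping and packages the witness;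
part 3 (`JensenMixedSplitRefutation.lean`) proves that every zero of `F'_{(kπ)²,ε}` is real and concludes the
HYPOTHESIS-FREE class-level refutation of the mixed-split exchange schema
«RH(T) ∧ RowBlock(m ≥ 1) ∧ FIN(D) ∧ LP* ∧ GORZ ⟹ E_jen».

Zero-definition raw form (cell convention): the seat's `Fw c ε` is SPELLED OUT everywhere as the lambda
`fun w : ℂ ↦ ((w + c) ^ 2 + (ε : ℂ) ^ 2) * coshSqrt w` (`coshSqrt` = the tree's `cosh √·`,
`Literature.Barriers.RiemannHypothesis.JensenPolynomialsSqrt`), its values beta-reduced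
(`((w + c)² + ε²)·cosh √w`), the planted pair `w± = -c ± iε` as `-(c : ℂ) ± ε * I`, the sea zeros
`s_j = -((2j+1)π/2)²` literally, and the seat's Props `DerivZerosReal c ε` («every zero of `F'_{c,ε}` is
real») / `MixedSplitWitness C D F` as the written-out `∀` / conjunction.  Theorem names keep the seat's
mnemonics (`Fw_…`, `quadr_…`, `wPlus_…`).  Proofs verbatim (three `rw [Fw]`-type unfoldings dropped).

Contents (all elementary, RH-free; `c ε : ℝ`):
* §1 zeros: `F_{c,ε}(w) = 0 ↔ w = -c ± iε ∨ cosh √w = 0` (`Fw_eq_zero_iff`); zeros of `cosh √w` are the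
  real sea `-((2j+1)π/2)²` (`exists_eq_seaZero_of_coshSqrt_eq_zero`); every zero of modulus `≤ c` is real
  (`im_eq_zero_of_Fw_eq_zero_of_norm_le` — the RH(T)-analogue, non-vacuous by `Fw_seaZero`, `norm_seaZero_le`);
  the non-real zeros are exactly the planted pair (`Fw_eq_zero_im_ne_zero_iff` — the LP*-analogue).
* §2 `F(conj w) = conj F(w)`, `F(0) = c² + ε² ≠ 0`, `F'` by the product rule (`deriv_Fw`), `F'(0) ≠ 0`, and the
  growth bounds `‖F(w)‖, ‖F'(w)‖ ≤ A·exp(‖w‖^{3/4})` giving `IsEntireOfOrderLtOne` for `F` and `F'`.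

HONEST LABEL: «SPLITTING SEARCH over kernel-typed RH-EQUIVALENCES; a splitting A ∧ B ⟹ RH is
CONDITIONAL bookkeeping unless A and B are both proved; nothing here bears on the truth of RH.»
-/

noncomputable section

set_option linter.dupNamespace false

open Complex Polynomial Filter Topology
open scoped Nat Real ComplexConjugate

namespace Summit.RiemannHypothesis.RiemannHypothesis.Theorems.Splittings.JensenMixedSplit

open Literature.Barriers.RiemannHypothesis
open Literature.NumberTheory.LFunctions (jensenPoly exists_sq_eq iteratedDeriv_conj_of_conj)
open Literature.Analysis.TotalPositivity (IsEntireOfOrderLtOne)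
open Literature.Analysis.Complex.Obreschkoff (sector mem_sector splits_jensenPoly_taylor_of_zeros_mem_sector)

/-! ## §1 Zero structure -/

/-- The quadratic factor splits: `(w + c)² + ε² = (w - w₊)(w - w₋)` with `w± = -c ± iε`. [folklore] -/
theorem quadr_eq_mul (c ε : ℝ) (w : ℂ) : ((w + c) ^ 2 + (ε : ℂ) ^ 2) = (w - (-(c : ℂ)
      + ε * I)) * (w - (-(c : ℂ) - ε * I)) := by
  linear_combination (ε : ℂ) ^ 2 * I_sq

/-- Zeros of the quadratic factor: `(w + c)² + ε² = 0 ↔ w = -c + iε ∨ w = -c - iε`. [folklore] -/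
theorem quadr_eq_zero_iff (c ε : ℝ) (w : ℂ) : ((w + c) ^ 2 + (ε : ℂ) ^ 2) = 0 ↔ w = (-(c : ℂ)
      + ε * I) ∨ w = (-(c : ℂ) - ε * I) := by
  rw [quadr_eq_mul, mul_eq_zero, sub_eq_zero, sub_eq_zero]

/-- Zeros of `F_{c,ε}(w) = ((w + c)² + ε²)·cosh √w`: the planted pair or a zero of `cosh √w`. [folklore] -/
theorem Fw_eq_zero_iff (c ε : ℝ) (w : ℂ) :
    ((w + c) ^ 2 + (ε : ℂ) ^ 2) * coshSqrt w = 0 ↔ (w = (-(c : ℂ) + ε * I) ∨ w =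
        (-(c : ℂ) - ε * I)) ∨ coshSqrt w = 0 := by
  rw [mul_eq_zero, quadr_eq_zero_iff]

/-- Zeros of `cosh √w` are the sea points (solve `cos (u I) = 0`). [folklore] -/
theorem exists_eq_seaZero_of_coshSqrt_eq_zero {w : ℂ} (hw : coshSqrt w = 0) :
    ∃ k : ℤ, w = -((((2 * k + 1) * Real.pi / 2) ^ 2 : ℝ) : ℂ) := by
  obtain ⟨u, rfl⟩ := exists_sq_eq w
  rw [coshSqrt_sq, ← Complex.cos_mul_I] at hw
  obtain ⟨k, hk⟩ := Complex.cos_eq_zero_iff.1 hw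
  refine ⟨k, ?_⟩
  have huI : u = (2 * k + 1) * π / 2 * (-I) := by
    have : u = u * I * (-I) := by rw [mul_assoc, mul_neg, I_mul_I, neg_neg, mul_one]
    rw [this, hk]
  rw [huI]; push_cast; ring_nf; rw [I_sq]; ring

/-- Hence every zero of `cosh √w` is real and `≤ 0`. [folklore] -/
theorem im_eq_zero_of_coshSqrt_eq_zero {w : ℂ} (hw : coshSqrt w = 0) : w.im = 0 ∧ w.re ≤ 0 := by
  obtain ⟨k, rfl⟩ := exists_eq_seaZero_of_coshSqrt_eq_zero hw
  simp only [neg_im, ofReal_im, neg_zero, neg_re, ofReal_re, Left.neg_nonpos_iff, true_and]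
  positivity

/-- `‖-c + iε‖ = √(c² + ε²)`. [folklore] -/
theorem norm_wPlus (c ε : ℝ) : ‖(-(c : ℂ) + ε * I)‖ = Real.sqrt (c ^ 2 + ε ^ 2) := by
  rw [show (-(c : ℂ) + ε * I) = ((-c : ℝ) : ℂ) + ε * I by push_cast; ring,
    Complex.norm_add_mul_I, neg_sq]

/-- `‖-c - iε‖ = √(c² + ε²)`. [folklore] -/
theorem norm_wMinus (c ε : ℝ) : ‖(-(c : ℂ) - ε * I)‖ = Real.sqrt (c ^ 2 + ε ^ 2) := by
  rw [show (-(c : ℂ) - ε * I) = ((-c : ℝ) : ℂ) + ((-ε : ℝ) : ℂ) * I by push_cast; ring,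
    Complex.norm_add_mul_I, neg_sq, neg_sq]

/-- The pair lies strictly outside the disc `‖w‖ ≤ c`. [folklore] -/
theorem lt_norm_wPlus {c ε : ℝ} (hc : 0 ≤ c) (hε : ε ≠ 0) : c < ‖(-(c : ℂ) + ε * I)‖ := by
  rw [norm_wPlus, Real.lt_sqrt hc]
  have : 0 < ε ^ 2 := by rw [sq]; exact mul_self_pos.2 hε
  linarith

/-- `c < ‖-c - iε‖` for `c ≥ 0`, `ε ≠ 0`. [folklore] -/
theorem lt_norm_wMinus {c ε : ℝ} (hc : 0 ≤ c) (hε : ε ≠ 0) : c < ‖(-(c : ℂ) - ε * I)‖ := by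
  rw [norm_wMinus, Real.lt_sqrt hc]
  have : 0 < ε ^ 2 := by rw [sq]; exact mul_self_pos.2 hε
  linarith

/-- **RH(T)-analogue.** Every zero of `F_{c,ε}` of modulus `≤ c` is real and `≤ 0`. [folklore] -/
theorem im_eq_zero_of_Fw_eq_zero_of_norm_le {c ε : ℝ} (hc : 0 ≤ c) (hε : ε ≠ 0) {w : ℂ}
    (hw : ((w + c) ^ 2 + (ε : ℂ) ^ 2) * coshSqrt w = 0) (hn : ‖w‖ ≤ c) : w.im = 0 ∧ w.re ≤ 0 := by
  rcases (Fw_eq_zero_iff c ε w).1 hw with (rfl | rfl) | h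
  · exact absurd hn (not_le.2 (lt_norm_wPlus hc hε))
  · exact absurd hn (not_le.2 (lt_norm_wMinus hc hε))
  · exact im_eq_zero_of_coshSqrt_eq_zero h

/-- The planted zero: `F(w₊) = 0` … [folklore] -/
theorem Fw_wPlus (c ε : ℝ) : (((-(c : ℂ) + ε * I) + c) ^ 2 + (ε : ℂ) ^ 2) * coshSqrt ((-(c : ℂ)
      + ε * I)) = 0 := by
  rw [Fw_eq_zero_iff]; exact Or.inl (Or.inl rfl)

/-- The conjugate planted zero: `F_{c,ε}(-c - iε) = 0`. [folklore] -/
theorem Fw_wMinus (c ε : ℝ) : (((-(c : ℂ) - ε * I) + c) ^ 2 + (ε : ℂ) ^ 2)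
      * coshSqrt ((-(c : ℂ) - ε * I)) = 0 := by
  rw [Fw_eq_zero_iff]; exact Or.inl (Or.inr rfl)

/-- … and it is NOT real when `ε ≠ 0` (so `F ∉` Laguerre–Pólya: the `¬ E_jen`-analogue below).
[folklore] -/
theorem wPlus_im (c ε : ℝ) : ((-(c : ℂ) + ε * I)).im = ε := by simp

/-- `Im(-c - iε) = -ε`. [folklore] -/
theorem wMinus_im (c ε : ℝ) : ((-(c : ℂ) - ε * I)).im = -ε := by simp

/-- LP*-analogue: the non-real zeros of `F` are exactly `w₊, w₋` (one conjugate pair). [folklore] -/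
theorem Fw_eq_zero_im_ne_zero_iff {c ε : ℝ} (hε : ε ≠ 0) (w : ℂ) :
    (((w + c) ^ 2 + (ε : ℂ) ^ 2) * coshSqrt w = 0 ∧ w.im ≠ 0) ↔ (w = (-(c : ℂ) + ε * I) ∨ w =
        (-(c : ℂ) - ε * I)) := by
  constructor
  · rintro ⟨hw, him⟩
    rcases (Fw_eq_zero_iff c ε w).1 hw with h | h
    · exact h
    · exact absurd (im_eq_zero_of_coshSqrt_eq_zero h).1 him
  · rintro (rfl | rfl)
    · exact ⟨Fw_wPlus c ε, by rw [wPlus_im]; exact hε⟩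
    · exact ⟨Fw_wMinus c ε, by rw [wMinus_im]; exact neg_ne_zero.2 hε⟩

/-- The sea zeros are zeros of `F`: `cosh √(s_j) = cos ((2j+1)π/2) = 0`. [folklore] -/
theorem Fw_seaZero (c ε : ℝ) (j : ℕ) : (((((-(((2 * j + 1) * Real.pi / 2) ^ 2) : ℝ)) : ℂ) + c) ^ 2
      + (ε : ℂ) ^ 2) * coshSqrt ((((-(((2 * j + 1) * Real.pi / 2) ^ 2) : ℝ)) : ℂ)) = 0 := by
  rw [Fw_eq_zero_iff]
  refine Or.inr ?_
  have h1 : (((-(((2 * j + 1) * Real.pi / 2) ^ 2) : ℝ)) : ℂ) = ((((2 * j + 1) * Real.pi / 2 : ℝ) : ℂ) * I) ^ 2 := by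
    rw [mul_pow, I_sq]; push_cast; ring
  rw [h1, coshSqrt_sq, Complex.cosh_mul_I]
  exact Complex.cos_eq_zero_iff.2 ⟨j, by push_cast; ring⟩

/-- Non-vacuity of the RH(T)-analogue: with `c = (kπ)²` the sea zeros `s_j`, `j < k`, have modulus `≤ c`.
[folklore] -/
theorem norm_seaZero_le {j k : ℕ} (hjk : j < k) : ‖(((-(((2 * j + 1) * Real.pi / 2) ^ 2) : ℝ)) : ℂ)‖ ≤
      ((k : ℝ) * Real.pi) ^ 2 := by
  rw [Complex.norm_real, Real.norm_eq_abs, abs_neg, abs_of_nonneg (sq_nonneg _)]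
  have hj : (2 * (j : ℝ) + 1) ≤ 2 * k := by exact_mod_cast (by omega : 2 * j + 1 ≤ 2 * k)
  have h1 : (2 * j + 1) * Real.pi / 2 ≤ k * Real.pi := by nlinarith [Real.pi_pos]
  have h0 : 0 ≤ (2 * (j : ℝ) + 1) * Real.pi / 2 := by positivity
  gcongr

/-! ## §2 Symmetry, values at `0`, growth -/

/-- `cosh √·` is real on the real axis: `cosh √(conj w) = conj (cosh √w)`. [folklore] -/
theorem coshSqrt_conj (w : ℂ) : coshSqrt (conj w) = conj (coshSqrt w) := by
  rw [coshSqrt_eq_tsum, coshSqrt_eq_tsum, Complex.conj_tsum]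
  refine tsum_congr fun k ↦ ?_
  rw [map_mul, map_pow]
  simp [coshSqrtCoeff]

/-- `F_{c,ε}` is real on the real axis: `F(conj w) = conj (F w)`. [folklore] -/
theorem Fw_conj (c ε : ℝ) (w : ℂ) : ((conj w + c) ^ 2 + (ε : ℂ) ^ 2) * coshSqrt (conj w) = conj (((w
      + c) ^ 2 + (ε : ℂ) ^ 2) * coshSqrt w) := by
  rw [coshSqrt_conj]
  simp [map_add, map_mul, map_pow, Complex.conj_ofReal]

/-- `F_{c,ε}(0) = c² + ε²`. [folklore] -/
theorem Fw_zero (c ε : ℝ) : (((0 : ℂ) + c) ^ 2 + (ε : ℂ) ^ 2) * coshSqrt ((0 : ℂ)) = ((c ^ 2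
      + ε ^ 2 : ℝ) : ℂ) := by
  rw [coshSqrt_zero]; push_cast; ring

/-- `F_{c,ε}(0) ≠ 0` when `ε ≠ 0`. [folklore] -/
theorem Fw_zero_ne {c ε : ℝ} (hε : ε ≠ 0) : (((0 : ℂ) + c) ^ 2 + (ε : ℂ) ^ 2) * coshSqrt ((0 : ℂ)) ≠ 0 := by
  rw [Fw_zero, Complex.ofReal_ne_zero]
  have h2 : 0 < ε ^ 2 := by rw [sq]; exact mul_self_pos.2 hε
  exact ne_of_gt (by have := sq_nonneg c; linarith)

/-- The quadratic factor is entire. [folklore] -/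
theorem differentiable_quadr (c ε : ℝ) : Differentiable ℂ ((fun w : ℂ ↦ (w + c) ^ 2 + (ε : ℂ) ^ 2)) := by
  fun_prop

/-- `F_{c,ε}` is entire. [folklore] -/
theorem differentiable_Fw (c ε : ℝ) : Differentiable ℂ ((fun w : ℂ ↦ ((w + c) ^ 2
      + (ε : ℂ) ^ 2) * coshSqrt w)) := by
  exact (differentiable_quadr c ε).mul differentiable_coshSqrt

/-- `d/dw ((w + c)² + ε²) = 2(w + c)`. [folklore] -/
theorem hasDerivAt_quadr (c ε : ℝ) (w : ℂ) : HasDerivAt ((fun w : ℂ ↦ (w + c) ^ 2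
      + (ε : ℂ) ^ 2)) (2 * (w + c)) w := by
  have h1 : HasDerivAt (fun y : ℂ ↦ y + c) 1 w := (hasDerivAt_id' w).add_const _
  have h2 : HasDerivAt (fun y : ℂ ↦ (y + c) * (y + c)) (1 * (w + c) + (w + c) * 1) w := h1.mul h1
  have h3 : HasDerivAt (fun y : ℂ ↦ (y + c) * (y + c) + (ε : ℂ) ^ 2) (1 * (w + c) + (w + c) * 1) w :=
    h2.add_const _
  have e1 : (fun y : ℂ ↦ (y + c) * (y + c) + (ε : ℂ) ^ 2) = (fun w : ℂ ↦ (w + c) ^ 2 + (ε : ℂ) ^ 2) := by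
    funext y; ring
  have e2 : 1 * (w + (c : ℂ)) + (w + c) * 1 = 2 * (w + c) := by ring
  rw [e1, e2] at h3
  exact h3

/-- Product rule for `F_{c,ε}`: `F' = 2(w + c)·cosh √w + ((w + c)² + ε²)·(cosh √·)'(w)`. [folklore] -/
theorem hasDerivAt_Fw (c ε : ℝ) (w : ℂ) :
    HasDerivAt ((fun w : ℂ ↦ ((w + c) ^ 2 + (ε : ℂ) ^ 2) * coshSqrt w)) (2 * (w + c) * coshSqrt w
        + ((w + c) ^ 2 + (ε : ℂ) ^ 2) * deriv coshSqrt w) w := by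
  exact (hasDerivAt_quadr c ε w).mul (differentiable_coshSqrt w).hasDerivAt

/-- `F'_{c,ε}(w) = 2(w + c)·cosh √w + ((w + c)² + ε²)·(cosh √·)'(w)`. [folklore] -/
theorem deriv_Fw (c ε : ℝ) (w : ℂ) :
    deriv ((fun w : ℂ ↦ ((w + c) ^ 2 + (ε : ℂ) ^ 2) * coshSqrt w)) w = 2 * (w + c) * coshSqrt w + ((w
        + c) ^ 2 + (ε : ℂ) ^ 2) * deriv coshSqrt w :=
  (hasDerivAt_Fw c ε w).deriv

/-- `F'(0) = 2c + (c² + ε²)/2`. [folklore] -/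
theorem deriv_Fw_zero (c ε : ℝ) : deriv ((fun w : ℂ ↦ ((w + c) ^ 2 + (ε : ℂ) ^ 2) * coshSqrt w)) 0 =
      ((2 * c + (c ^ 2 + ε ^ 2) / 2 : ℝ) : ℂ) := by
  rw [deriv_Fw, coshSqrt_zero, deriv_coshSqrt_zero]; push_cast; ring

/-- `F'_{c,ε}(0) ≠ 0` for `c ≥ 0`, `ε ≠ 0`. [folklore] -/
theorem deriv_Fw_zero_ne {c ε : ℝ} (hc : 0 ≤ c) (hε : ε ≠ 0) : deriv ((fun w : ℂ ↦ ((w + c) ^ 2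
      + (ε : ℂ) ^ 2) * coshSqrt w)) 0 ≠ 0 := by
  rw [deriv_Fw_zero, Complex.ofReal_ne_zero]
  have h2 : 0 < ε ^ 2 := by rw [sq]; exact mul_self_pos.2 hε
  exact ne_of_gt (by have := sq_nonneg c; nlinarith)

/-- Polynomial weights are absorbed: `(s² + a)² + b ≤ (29 (1 + a)² + b) · e^s` for `s, a, b ≥ 0`.
[folklore] -/
theorem quartic_le_exp {s a b : ℝ} (hs : 0 ≤ s) (ha : 0 ≤ a) (hb : 0 ≤ b) :
    (s ^ 2 + a) ^ 2 + b ≤ (29 * (1 + a) ^ 2 + b) * Real.exp s := by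
  have hexp1 : 1 ≤ Real.exp s := Real.one_le_exp hs
  have h4 : s ^ 4 ≤ 24 * Real.exp s := by
    have := Real.pow_div_factorial_le_exp s hs 4
    rw [show ((4 : ℕ)! : ℝ) = 24 by norm_num [Nat.factorial], div_le_iff₀ (by norm_num)] at this
    linarith
  have h2 : s ^ 2 ≤ 2 * Real.exp s := by
    have := Real.pow_div_factorial_le_exp s hs 2
    rw [show ((2 : ℕ)! : ℝ) = 2 by norm_num [Nat.factorial], div_le_iff₀ (by norm_num)] at this
    linarith
  have hsa : s ^ 2 + a ≤ (1 + a) * (s ^ 2 + 1) := by nlinarith [sq_nonneg s]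
  have hsa0 : 0 ≤ s ^ 2 + a := by positivity
  have hsq : (s ^ 2 + a) ^ 2 ≤ (1 + a) ^ 2 * (s ^ 2 + 1) ^ 2 := by
    rw [← mul_pow]; gcongr
  have h29 : (s ^ 2 + 1) ^ 2 ≤ 29 * Real.exp s := by nlinarith [h4, h2, hexp1, sq_nonneg s]
  have hb' : b ≤ b * Real.exp s := le_mul_of_one_le_right hb hexp1
  nlinarith [hsq, h29, hb', sq_nonneg (1 + a), Real.exp_pos s]

/-- `‖q_{c,ε}(w)‖ ≤ (29 (1+|c|)² + ε²) · exp(‖w‖^{1/2})`. [folklore] -/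
theorem norm_quadr_le (c ε : ℝ) (w : ℂ) :
    ‖((w + c) ^ 2 + (ε : ℂ) ^ 2)‖ ≤ (29 * (1 + |c|) ^ 2 + ε ^ 2) * Real.exp (‖w‖ ^ (1 / 2 : ℝ)) := by
  set s : ℝ := ‖w‖ ^ (1 / 2 : ℝ) with hs
  have hs0 : 0 ≤ s := Real.rpow_nonneg (norm_nonneg w) _
  have hsq : ‖w‖ = s ^ 2 := by
    rw [hs, ← Real.rpow_natCast, ← Real.rpow_mul (norm_nonneg w)]; norm_num
  calc ‖((w + c) ^ 2 + (ε : ℂ) ^ 2)‖ ≤ ‖(w + c) ^ 2‖ + ‖(ε : ℂ) ^ 2‖ := norm_add_le _ _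
    _ = ‖w + c‖ ^ 2 + ε ^ 2 := by
        rw [norm_pow, norm_pow, Complex.norm_real, Real.norm_eq_abs, sq_abs]
    _ ≤ (‖w‖ + |c|) ^ 2 + ε ^ 2 := by
        gcongr
        calc ‖w + c‖ ≤ ‖w‖ + ‖(c : ℂ)‖ := norm_add_le _ _
          _ = ‖w‖ + |c| := by rw [Complex.norm_real, Real.norm_eq_abs]
    _ = (s ^ 2 + |c|) ^ 2 + ε ^ 2 := by rw [hsq]
    _ ≤ (29 * (1 + |c|) ^ 2 + ε ^ 2) * Real.exp s := quartic_le_exp hs0 (abs_nonneg c) (sq_nonneg ε)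

/-- `2 ‖w‖^{1/2} ≤ ‖w‖^{3/4} + 8`. [folklore] -/
theorem two_sqrt_le (w : ℂ) : 2 * ‖w‖ ^ (1 / 2 : ℝ) ≤ ‖w‖ ^ (3 / 4 : ℝ) + 8 := by
  have h := two_mul_le_rpow_three_halves_add (Real.rpow_nonneg (norm_nonneg w) (1 / 2 : ℝ))
  have : (‖w‖ ^ (1 / 2 : ℝ)) ^ (3 / 2 : ℝ) = ‖w‖ ^ (3 / 4 : ℝ) := by
    rw [← Real.rpow_mul (norm_nonneg w)]; norm_num
  linarith

/-- Growth of `F`: order `1/2 < 1` (crudely, `ρ = 3/4`). [folklore] -/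
theorem norm_Fw_le (c ε : ℝ) (w : ℂ) :
    ‖((w + c) ^ 2 + (ε : ℂ) ^ 2) * coshSqrt w‖ ≤ (29 * (1 + |c|) ^ 2
        + ε ^ 2) * Real.exp 8 * Real.exp (‖w‖ ^ (3 / 4 : ℝ)) := by
  have hA : 0 ≤ 29 * (1 + |c|) ^ 2 + ε ^ 2 := by positivity
  calc ‖((w + c) ^ 2 + (ε : ℂ) ^ 2) * coshSqrt w‖ = ‖((w + c) ^ 2 + (ε : ℂ) ^ 2)‖ * ‖coshSqrt w‖ := norm_mul _ _
    _ ≤ (29 * (1 + |c|) ^ 2 + ε ^ 2) * Real.exp (‖w‖ ^ (1 / 2 : ℝ)) * Real.exp (‖w‖ ^ (1 / 2 : ℝ)) := by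
        gcongr
        · exact norm_quadr_le c ε w
        · exact norm_coshSqrt_le w
    _ = (29 * (1 + |c|) ^ 2 + ε ^ 2) * Real.exp (2 * ‖w‖ ^ (1 / 2 : ℝ)) := by
        rw [mul_assoc, ← Real.exp_add]; ring_nf
    _ ≤ (29 * (1 + |c|) ^ 2 + ε ^ 2) * Real.exp (‖w‖ ^ (3 / 4 : ℝ) + 8) := by
        gcongr; exact two_sqrt_le w
    _ = (29 * (1 + |c|) ^ 2 + ε ^ 2) * Real.exp 8 * Real.exp (‖w‖ ^ (3 / 4 : ℝ)) := by
        rw [Real.exp_add]; ring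

/-- `F_{c,ε}` is entire of order `< 1` (exponent `3/4`). [folklore] -/
theorem isEntireOfOrderLtOne_Fw (c ε : ℝ) : IsEntireOfOrderLtOne ((fun w : ℂ ↦ ((w + c) ^ 2
      + (ε : ℂ) ^ 2) * coshSqrt w)) :=
  ⟨differentiable_Fw c ε, 3 / 4, (29 * (1 + |c|) ^ 2 + ε ^ 2) * Real.exp 8, by norm_num,
    norm_Fw_le c ε⟩

/-- Growth of `F'` (product rule + the tree's Cauchy estimate for `(cosh √·)'`). [folklore] -/
theorem norm_deriv_Fw_le (c ε : ℝ) (w : ℂ) :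
    ‖deriv ((fun w : ℂ ↦ ((w + c) ^ 2 + (ε : ℂ) ^ 2) * coshSqrt w)) w‖ ≤ (6 * (1 + |c|) + (29 * (1
        + |c|) ^ 2 + ε ^ 2) * Real.exp 1) * Real.exp 8 *
      Real.exp (‖w‖ ^ (3 / 4 : ℝ)) := by
  set s : ℝ := ‖w‖ ^ (1 / 2 : ℝ) with hs
  have hs0 : 0 ≤ s := Real.rpow_nonneg (norm_nonneg w) _
  have hsq : ‖w‖ = s ^ 2 := by
    rw [hs, ← Real.rpow_natCast, ← Real.rpow_mul (norm_nonneg w)]; norm_num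
  have hexp1 : 1 ≤ Real.exp s := Real.one_le_exp hs0
  have h2 : s ^ 2 ≤ 2 * Real.exp s := by
    have := Real.pow_div_factorial_le_exp s hs0 2
    rw [show ((2 : ℕ)! : ℝ) = 2 by norm_num [Nat.factorial], div_le_iff₀ (by norm_num)] at this
    linarith
  have hlin : ‖2 * (w + c)‖ ≤ 6 * (1 + |c|) * Real.exp s := by
    calc ‖2 * (w + c)‖ = 2 * ‖w + c‖ := by rw [norm_mul]; norm_num
      _ ≤ 2 * (‖w‖ + |c|) := by
          gcongr
          calc ‖w + c‖ ≤ ‖w‖ + ‖(c : ℂ)‖ := norm_add_le _ _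
            _ = ‖w‖ + |c| := by rw [Complex.norm_real, Real.norm_eq_abs]
      _ = 2 * (s ^ 2 + |c|) := by rw [hsq]
      _ ≤ 6 * (1 + |c|) * Real.exp s := by
          have hc' : |c| ≤ |c| * Real.exp s := le_mul_of_one_le_right (abs_nonneg c) hexp1
          nlinarith [h2, hc', hexp1, abs_nonneg c]
  have hA : 0 ≤ 29 * (1 + |c|) ^ 2 + ε ^ 2 := by positivity
  have hB : 0 ≤ 6 * (1 + |c|) + (29 * (1 + |c|) ^ 2 + ε ^ 2) * Real.exp 1 := by positivity
  calc ‖deriv ((fun w : ℂ ↦ ((w + c) ^ 2 + (ε : ℂ) ^ 2) * coshSqrt w)) w‖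
      = ‖2 * (w + c) * coshSqrt w + ((w + c) ^ 2 + (ε : ℂ) ^ 2) * deriv coshSqrt w‖ := by rw [deriv_Fw]
    _ ≤ ‖2 * (w + c)‖ * ‖coshSqrt w‖ + ‖((w + c) ^ 2 + (ε : ℂ) ^ 2)‖ * ‖deriv coshSqrt w‖ := by
        refine (norm_add_le _ _).trans ?_
        rw [norm_mul (2 * (w + ↑c)) (coshSqrt w), norm_mul (((w + c) ^ 2 + (ε : ℂ) ^ 2)) (deriv coshSqrt w)]
    _ ≤ 6 * (1 + |c|) * Real.exp s * Real.exp s +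
          (29 * (1 + |c|) ^ 2 + ε ^ 2) * Real.exp s * (Real.exp 1 * Real.exp s) :=
        add_le_add (mul_le_mul hlin (norm_coshSqrt_le w) (norm_nonneg _) (by positivity))
          (mul_le_mul (norm_quadr_le c ε w) (norm_deriv_coshSqrt_le w) (norm_nonneg _)
            (by positivity))
    _ = (6 * (1 + |c|) + (29 * (1 + |c|) ^ 2 + ε ^ 2) * Real.exp 1) * Real.exp (2 * s) := by
        rw [show (2 : ℝ) * s = s + s by ring, Real.exp_add]; ring
    _ ≤ (6 * (1 + |c|) + (29 * (1 + |c|) ^ 2 + ε ^ 2) * Real.exp 1) *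
          Real.exp (‖w‖ ^ (3 / 4 : ℝ) + 8) := by
        gcongr; exact two_sqrt_le w
    _ = (6 * (1 + |c|) + (29 * (1 + |c|) ^ 2 + ε ^ 2) * Real.exp 1) * Real.exp 8 *
          Real.exp (‖w‖ ^ (3 / 4 : ℝ)) := by
        rw [Real.exp_add]; ring

/-- `F'_{c,ε}` is entire. [folklore] -/
theorem differentiable_deriv_Fw (c ε : ℝ) : Differentiable ℂ (deriv ((fun w : ℂ ↦ ((w + c) ^ 2
      + (ε : ℂ) ^ 2) * coshSqrt w))) := fun z ↦
  (((differentiable_Fw c ε).analyticAt z).deriv).differentiableAt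

/-- `F'_{c,ε}` is entire of order `< 1` (exponent `3/4`). [folklore] -/
theorem isEntireOfOrderLtOne_deriv_Fw (c ε : ℝ) : IsEntireOfOrderLtOne (deriv ((fun w : ℂ ↦ ((w
      + c) ^ 2 + (ε : ℂ) ^ 2) * coshSqrt w))) :=
  ⟨differentiable_deriv_Fw c ε, 3 / 4, _, by norm_num, norm_deriv_Fw_le c ε⟩

end Summit.RiemannHypothesis.RiemannHypothesis.Theorems.Splittings.JensenMixedSplit

end
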